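import Mathlib
import Literature.NumberTheory.Transcendental.GammaIsoCross
import Literature.NumberTheory.Transcendental.ZilberGenericClosedness
import Literature.NumberTheory.Transcendental.PseudoExpVariants
import Literature.NumberTheory.Transcendental.PseudoExpAmbient
import Literature.NumberTheory.Transcendental.GammaFieldsEcl
import Summits.Schanuel.Schanuel.Theorems.RigidCoreAclSubsetLogFreeCoreDoubleBaseAux1
import Summits.Schanuel.Schanuel.Theorems.RigidCoreAclSubsetLogFreeCoreDoubleBaseAux5

/-!
# Stub `stub_doubleBase` (line `eac-extends-core-automorphisms`, crux stmt-Schanuel-0968):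
the double of a free strong extension, base half

For `X = ℚτ + ℚc ◁ ℂ_exp` (`τ = 2πi`) and a tuple `e`, `ℚ`-linearly independent and *free* over
`X` (no non-zero `ℤ`-combination of `e`, nor its exponential, is algebraic over the Γ-field
`ℚ(gens X)`), put `W = X + ℚe` and `F = ℚ(gens W)`. We construct the **abstract double** of `W`
over `X`: a finitely generated partial exponential field with standard kernel `(K, D, θ, t)`
(`Literature.NumberTheory.Transcendental.IsStdKernelPartialExpField`, Bays–Kirby 2018 §9.2) inside
`ℂ` together with two field embeddings `j₁ = incl`, `j₂ = φ : F → K` agreeing on the generators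
of the Γ-field of `X` at all Kummer levels, with `D = j₁ W + j₂ W`, `θ` extending `exp` along
both copies, the first copy strong in `(K, D, θ)`, and the two copies in general position.

The second copy is a **generic field embedding** `φ : F → ℂ` over `ℚ(gens X)`
(`DoubleBase.exists_isGenericEmb`, auxiliary file 1: Steinitz embedding along fresh
transcendentals; its image is algebraically disjoint from `F` over `ℚ(gens X)`); the partial
exponential `θ(w + φ w') = exp w · φ(exp w')` on `D_ℂ = W + φ(W)` is well defined with kernel
`ℤτ` by freeness (auxiliary files 2–3); `K = ℚ(D_ℂ ∪ θ D_ℂ) ≤ ℂ` is a finitely generated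
partial exponential field with standard kernel (auxiliary file 4, after the template
`Literature.Barriers.Schanuel.exists_isStdKernelPartialExpField`); internal strongness of the
first copy is `X ◁ ℂ` transported by `φ` plus algebraic disjointness (auxiliary file 5). This
file assembles the seven conjuncts. No definitions are introduced anywhere: all objects are
local (notations) or existentially produced.

## References

* M. Bays, J. Kirby, *Pseudo-exponential maps, variants, and quasiminimality*, Algebra & Number
  Theory 12 (2018) 493–549: §9.2 (finitely generated partial exponential fields with standard
  kernel as bases), Def. 4.3 (strong extensions).
* J. Kirby, *Finitely presented exponential fields*, Algebra & Number Theory 7 (2013) 943–980,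
  §3–4 (free amalgamation of partial exponential fields).
-/

noncomputable section

set_option linter.dupNamespace false

open Set
open scoped Matroid
open Literature.ModelTheory.ExponentialFields Literature.ModelTheory.ExponentialFields.ExponentialRing
open Literature.NumberTheory.Transcendental Literature.NumberTheory.Transcendental.GammaField

namespace Summit.Schanuel.Schanuel.Theorems.RigidCore

/-- **Stub `stub_doubleBase` — the double of a free strong extension, base half.** Let
`X = ℚτ + ℚc ◁ ℂ` (`τ = 2πi`) and `e` a tuple, `ℚ`-linearly independent and free over `X`; put
`W = X + ℚe`. Then there are a subfield `F ≤ ℂ` containing `W` and all `exp (x/M!)` (`x ∈ W`),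
a field `K` with a finite-dimensional `ℚ`-subspace `D`, a partial exponential `θ` and `t ∈ D`
forming a finitely generated partial exponential field with standard kernel, and two field
embeddings `j₁ j₂ : F → K` which agree on the generators of the Γ-field of `X`, send `τ ↦ t`,
with `D = span (j₁ W ∪ j₂ W)`, `θ` extending `exp` along both copies, the first copy strong in
`(K, D, θ)`, and the copies in general position. Construction: `F = ℚ(gens W)`, a generic
field embedding `φ : F → ℂ` over `ℚ(gens X)` (`DoubleBase.exists_isGenericEmb`), `D_ℂ = W + φ W`,
`θ(w + φ w') = exp w · φ(exp w')` (kernel `ℤτ` by freeness; `DoubleBase.exists_theta`),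
`K = ℚ(D_ℂ ∪ θ D_ℂ) ≤ ℂ`, `j₁ = incl`, `j₂ = φ`; strongness of the first copy is `X ◁ ℂ`
transported by `φ` plus algebraic disjointness of `φ(F)` and `F` over `ℚ(gens X)`
(`DoubleBase.strongK`). (Bays–Kirby 2018 §9.2 bases; Kirby 2013 free amalgamation.) -/
theorem stub_doubleBase (τ : ℂ) (hτ : τ = 2 * ↑Real.pi * Complex.I)
    {N k : ℕ} (c : Fin N → ℂ) (e : Fin k → ℂ)
    (hX : IsStrong (Submodule.span ℚ ({τ} : Set ℂ) ⊔ Submodule.span ℚ (range c)))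
    (hlin : LinIndepOver (Submodule.span ℚ ({τ} : Set ℂ) ⊔ Submodule.span ℚ (range c)) e)
    (hfree : ∀ m : Fin k → ℤ, m ≠ 0 →
      (∑ j, (m j : ℚ) • e j) ∉ acl (gens (Submodule.span ℚ ({τ} : Set ℂ) ⊔ Submodule.span ℚ (range c))) ∧
      Complex.exp (∑ j, (m j : ℚ) • e j) ∉ acl (gens (Submodule.span ℚ ({τ} : Set ℂ) ⊔
        Submodule.span ℚ (range c)))) :
    ∃ (F : IntermediateField ℚ ℂ)
      (_ : ∀ x ∈ Submodule.span ℚ ({τ} : Set ℂ) ⊔ Submodule.span ℚ (range (Fin.append c e)),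
        x ∈ F ∧ ∀ M : ℕ, Complex.exp (x / (M.factorial : ℂ)) ∈ F)
      (K : Type) (_ : Field K) (_ : CharZero K) (D : Submodule ℚ K) (θ : K → K) (t : K)
      (j₁ j₂ : F →+* K),
      IsStdKernelPartialExpField K D θ t ∧
      (∀ hτF : τ ∈ F, j₁ ⟨τ, hτF⟩ = t ∧ j₂ ⟨τ, hτF⟩ = t) ∧
      (∀ (x : ℂ) (hxF : x ∈ F),
        (x ∈ Submodule.span ℚ ({τ} : Set ℂ) ⊔ Submodule.span ℚ (range c) ∨
          ∃ y ∈ Submodule.span ℚ ({τ} : Set ℂ) ⊔ Submodule.span ℚ (range c), ∃ M : ℕ,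
            x = Complex.exp (y / (M.factorial : ℂ))) →
        j₁ ⟨x, hxF⟩ = j₂ ⟨x, hxF⟩) ∧
      D = Submodule.span ℚ
        ((fun x : F => j₁ x) '' {x : F | (x : ℂ) ∈ Submodule.span ℚ ({τ} : Set ℂ) ⊔
            Submodule.span ℚ (range (Fin.append c e))} ∪
          (fun x : F => j₂ x) '' {x : F | (x : ℂ) ∈ Submodule.span ℚ ({τ} : Set ℂ) ⊔
            Submodule.span ℚ (range (Fin.append c e))}) ∧
      (∀ (x : ℂ) (hxF : x ∈ F) (hexF : Complex.exp x ∈ F),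
        x ∈ Submodule.span ℚ ({τ} : Set ℂ) ⊔ Submodule.span ℚ (range (Fin.append c e)) →
        θ (j₁ ⟨x, hxF⟩) = j₁ ⟨Complex.exp x, hexF⟩ ∧ θ (j₂ ⟨x, hxF⟩) = j₂ ⟨Complex.exp x, hexF⟩) ∧
      (∀ V : Submodule ℚ K,
        Submodule.span ℚ ((fun x : F => j₁ x) '' {x : F | (x : ℂ) ∈ Submodule.span ℚ ({τ} : Set ℂ) ⊔
            Submodule.span ℚ (range (Fin.append c e))}) ≤ V → V ≤ D →
        ((ldim (Submodule.span ℚ ((fun x : F => j₁ x) '' {x : F | (x : ℂ) ∈ Submodule.span ℚ ({τ} : Set ℂ) ⊔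
            Submodule.span ℚ (range (Fin.append c e))})) V : ℕ) : ℕ∞) ≤
          (algMatroid K).relRank
            (↑(Submodule.span ℚ ((fun x : F => j₁ x) '' {x : F | (x : ℂ) ∈ Submodule.span ℚ ({τ} : Set ℂ) ⊔
              Submodule.span ℚ (range (Fin.append c e))})) ∪
              θ '' ↑(Submodule.span ℚ ((fun x : F => j₁ x) '' {x : F | (x : ℂ) ∈
                Submodule.span ℚ ({τ} : Set ℂ) ⊔ Submodule.span ℚ (range (Fin.append c e))})))
            (↑V ∪ θ '' ↑V)) ∧
      (∀ (hcF : ∀ i, c i ∈ F) (heF : ∀ j, e j ∈ F) (q : Fin k → ℚ), q ≠ 0 →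
        (∑ j, q j • (j₂ ⟨e j, heF j⟩ - j₁ ⟨e j, heF j⟩)) ∉
          Submodule.span ℚ ({t} : Set K) ⊔ Submodule.span ℚ (range fun i => j₁ ⟨c i, hcF i⟩)) := by
  classical
  -- the generic second copy `φ` and `e' = φ ∘ e`
  obtain ⟨φ, hfix, hrel⟩ := DoubleBase.exists_isGenericEmb
    (fieldOf (Submodule.span ℚ ({τ} : Set ℂ) ⊔ Submodule.span ℚ (range c)))
    (fieldOf (Submodule.span ℚ ({τ} : Set ℂ) ⊔ Submodule.span ℚ (range (Fin.append c e))))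
    (DoubleBase.fieldOf_Xsp_le τ c e) (DoubleBase.relRank_fieldOf_Fd_lt_top τ c e)
    (DoubleBase.countable_Fd τ c e)
  set e' : Fin k → ℂ := fun j => φ ⟨e j, DoubleBase.mem_Fd_of_mem (DoubleBase.e_mem_Wsp τ c e j)⟩
    with he'def
  have he' : ∀ (j : Fin k) (h : e j ∈ fieldOf (Submodule.span ℚ ({τ} : Set ℂ) ⊔
      Submodule.span ℚ (range (Fin.append c e)))), φ ⟨e j, h⟩ = e' j := fun j h => rfl
  -- the partial exponential on `D_ℂ = W + ℚe'`
  obtain ⟨θ, hθ⟩ := DoubleBase.exists_theta he' hlin hfree hfix hrel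
  -- the field `K = ℚ(D_ℂ ∪ θ D_ℂ)` and the data on it
  set Dc : Submodule ℚ ℂ := (Submodule.span ℚ ({τ} : Set ℂ) ⊔
    Submodule.span ℚ (range (Fin.append c e))) ⊔ Submodule.span ℚ (range e') with hDc
  set K : Subfield ℂ := Subfield.closure ((Dc : Set ℂ) ∪ θ '' (Dc : Set ℂ)) with hK
  have hDK : ∀ z ∈ Dc, z ∈ K := fun z hz => Subfield.subset_closure (Or.inl hz)
  have hθKm : ∀ z ∈ Dc, θ z ∈ K := fun z hz => Subfield.subset_closure (Or.inr ⟨z, hz, rfl⟩)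
  obtain ⟨v, hv⟩ := DoubleBase.exists_linearMap_coe_eq K
  obtain ⟨j₁, hj₁⟩ := DoubleBase.exists_ringHom_coe_eq K (algebraMap _ ℂ)
    (DoubleBase.coe_mem_K hθ hDK hθKm)
  have hj₁' : ∀ x, (j₁ x : ℂ) = x := fun x => hj₁ x
  obtain ⟨j₂, hj₂⟩ := DoubleBase.exists_ringHom_coe_eq K φ
    (DoubleBase.phi_mem_K hθ he' hfix hDK hθKm)
  obtain ⟨θK, hθK⟩ := DoubleBase.exists_thetaK K hθKm
  have hτK : τ ∈ K := hDK τ (Submodule.mem_sup_left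
    (DoubleBase.Xsp_le_Wsp e (DoubleBase.tau_mem_Xsp τ c)))
  refine ⟨fieldOf (Submodule.span ℚ ({τ} : Set ℂ) ⊔ Submodule.span ℚ (range (Fin.append c e))),
    fun x hx => DoubleBase.mem_Fd_and_exp_div_mem hx, K, inferInstance, inferInstance, _, θK,
    ⟨τ, hτK⟩, j₁, j₂,
    DoubleBase.isStdKernelPartialExpField hθ he' hlin hfree hfix hrel hτ hDK le_rfl hj₁' hj₂ hv
      hθK rfl,
    fun hτF => DoubleBase.j_tau hfix hj₁' hj₂ rfl hτF,
    fun x hxF h => DoubleBase.j_agree hfix hj₁' hj₂ x hxF h, rfl,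
    fun x hxF hexF hxW => DoubleBase.theta_j hθ he' hfix hj₁' hj₂ hθK x hxF hexF hxW,
    fun V hV1 hV2 => DoubleBase.strongK hθ he' hlin hfree hfix hrel hX hj₁' hj₂ hv hθK V hV1 hV2,
    fun hcF heF q hq => DoubleBase.genPos he' hlin hfree hfix hrel hj₁' hj₂ hv rfl hcF heF q hq⟩

end Summit.Schanuel.Schanuel.Theorems.RigidCore
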